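import Literature.Topology.FourManifolds.TubeReparam
import Literature.Topology.FourManifolds.FibreStraightening
import Mathlib.Analysis.CStarAlgebra.Matrix
import HarnessLib

/-!
# Moving the tube of a Gompf sphere: `X^γ_A ≅ X^{γ'}_A` for uniformly close straightenings

Towards **W** (`Literature.Topology.FourManifolds.gompf2010_straightening_invariance`: Gompf's `X^σ_A` depends only on the
straightening *class* `σ = [γ]`, Gompf 2010 Def. 4.1 and §4 ¶2). This file proves the local step:
if two smooth matrix paths `γ, γ' : 1 ⟿ A` are uniformly close in the sense that the *fibre
transition operators* `P(θ) := γ(θ)⁻¹ γ'(θ)` stay within a fixed threshold of the identity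
(`Literature.TubeClose γ γ'` and `Literature.TubeClose γ' γ`), then `gompfSphere A γ ≃ₘ gompfSphere A γ'`
(`Literature.Topology.FourManifolds.nonempty_diffeomorph_gompfSphere_of_tubeClose`).

## The argument (Gompf–Stipsicz §5.2: the surgered manifold does not change when the tube is
reparametrised by a diffeomorphism of `𝕊¹ × ℝ³` fixing the zero section)

Both spheres are surgeries of the *same* mapping torus `CSTorus A` along the *same* section circle
(`Literature.Topology.FourManifolds.sectionCircle_eq`); only the tubes `ν_γ, ν_{γ'} : 𝕊¹ × ℝ³ ↪ CSTorus A` differ: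
`ν_γ (u, w) = [s, expT (γ(2s) · sh_ε w)]` with `sh_ε = univBall 0 ε`, `ε = twistRadius A γ`.
With `κ := ε'/ε ≤ 1` and `P_u := γ(2s)⁻¹ γ'(2s)` one has *on the unit ball*
`ν_{γ'} (u, w) = ν_γ (u, F_u w)` for `F_u := sh_ε⁻¹ ∘ (κ P_u) ∘ sh_ε`
(`Literature.Topology.FourManifolds.secNbhdFun_eq_moveFibre`), and `F_u` extends to the diffeomorphism
`Literature.tubeFibreFun ε κ P_u` of `ℝ³` (identity off `B(0, 7/2)`, fixing `0`; file
`FibreStraightening`). The family `u ↦ P_u` is smooth on `𝕊¹` (read through either angle chart,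
`Literature.Topology.FourManifolds.contMDiff_moveCLM`), so `(u, w) ↦ (u, F_u w)` is a `TubeDiffeo` (`Literature.Topology.FourManifolds.moveTubeDiffeo`, via
`Literature.Topology.FourManifolds.fibrewiseDiffeomorph`), and `TubeReparam`'s
`CircleNbhd.nonempty_diffeomorph_surgered_of_eqOn_twist` (uniqueness of open gluings) gives the
diffeomorphism of the surgered manifolds. If instead `ε' > ε`, swap the roles of `γ, γ'`.

## References
* R. E. Gompf, *More Cappell–Shaneson spheres are standard*, AGT 10 (2010), Def. 4.1, §4.
* R. E. Gompf, A. I. Stipsicz, *4-Manifolds and Kirby Calculus*, GSM 20 (1999), §5.2.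
-/

noncomputable section

open scoped Manifold ContDiff Topology
open Set Function Metric

universe u

namespace Literature.Topology.FourManifolds

/-- Local notation: `𝔼 n` is the model Euclidean space `EuclideanSpace ℝ (Fin n)`. -/
local notation "𝔼 " n:arg => EuclideanSpace ℝ (Fin n)

/-- Local notation: `𝕊 n` is the unit sphere in `EuclideanSpace ℝ (Fin (n + 1))`. -/
local notation "𝕊 " n:arg => (Metric.sphere (0 : EuclideanSpace ℝ (Fin (n + 1))) 1 : Set _)

/-! ### Square matrices as operators on `𝔼 3` -/

section MatrixCLM

/-- A real `3 × 3` matrix as a continuous linear operator on `𝔼 3` (Mathlib's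
`Matrix.toEuclideanCLM`). [folklore] -/
abbrev matCLM (N : Matrix (Fin 3) (Fin 3) ℝ) : 𝔼 3 →L[ℝ] 𝔼 3 :=
  Matrix.toEuclideanCLM (n := Fin 3) (𝕜 := ℝ) N

/-- `matCLM N v = mulVecE N v`. [folklore] -/
theorem matCLM_apply (N : Matrix (Fin 3) (Fin 3) ℝ) (v : 𝔼 3) : matCLM N v = mulVecE N v := by
  rw [mulVecE_eq_toEuclideanLin]
  rfl

/-- `matCLM` is multiplicative. [folklore] -/
theorem matCLM_mul (N N' : Matrix (Fin 3) (Fin 3) ℝ) : matCLM (N * N') = matCLM N * matCLM N' :=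
  map_mul _ _ _

/-- `matCLM 1 = 1`. [folklore] -/
theorem matCLM_one : matCLM 1 = 1 := map_one _

/-- `matCLM` is additive: differences. [folklore] -/
theorem matCLM_sub (N N' : Matrix (Fin 3) (Fin 3) ℝ) : matCLM (N - N') = matCLM N - matCLM N' :=
  map_sub _ _ _

/-- `matCLM` is `ℝ`-linear: scalar matrices go to scalar operators. [folklore] -/
theorem matCLM_smul_one (r : ℝ) : matCLM (r • 1) = r • (1 : 𝔼 3 →L[ℝ] 𝔼 3) := by
  rw [← matCLM_one]
  exact map_smul (Matrix.toEuclideanCLM (n := Fin 3) (𝕜 := ℝ)) r 1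

/-- **An entrywise smooth matrix family is smooth as an operator family.** [folklore] -/
theorem contDiff_matCLM {m : ℝ → Matrix (Fin 3) (Fin 3) ℝ}
    (hm : ∀ i j, ContDiff ℝ ∞ fun θ ↦ m θ i j) : ContDiff ℝ ∞ fun θ ↦ matCLM (m θ) := by
  have h : ∀ θ, matCLM (m θ) = ∑ i, ∑ j, m θ i j • matCLM (Matrix.single i j 1) := by
    intro θ
    conv_lhs => rw [Matrix.matrix_eq_sum_single (m θ)]
    simp only [map_sum]
    refine Finset.sum_congr rfl fun i _ ↦ Finset.sum_congr rfl fun j _ ↦ ?_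
    rw [← map_smul, Matrix.smul_single, smul_eq_mul, mul_one]
  simp_rw [h]
  exact ContDiff.sum fun i _ ↦ ContDiff.sum fun j _ ↦ (hm i j).smul contDiff_const

end MatrixCLM

/-! ### The fibre transition operators of two straightenings -/

section MoveOp

variable {M₀ : Matrix (Fin 3) (Fin 3) ℝ} (γ γ' : SmoothMatrixPath M₀)

/-- **The fibre transition operator** `P_{γ,γ'}(θ) := γ(θ)⁻¹ γ'(θ)` of two smooth matrix paths
with the same end point, as an operator on `𝔼 3`. [folklore] -/
def moveOp (θ : ℝ) : 𝔼 3 →L[ℝ] 𝔼 3 := matCLM (γ.inv θ * γ'.toFun θ)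

/-- `P(θ) = 1` for `θ ≤ 0` (both paths sit at `1`). [folklore] -/
theorem moveOp_of_le_zero {θ : ℝ} (hθ : θ ≤ 0) : moveOp γ γ' θ = 1 := by
  rw [moveOp, γ.inv_eq_one hθ, γ'.eq_one θ hθ, Matrix.one_mul, matCLM_one]

/-- `P(θ) = 1` for `θ ≥ 1` (both paths sit at the common end point). [folklore] -/
theorem moveOp_of_one_le {θ : ℝ} (hθ : 1 ≤ θ) : moveOp γ γ' θ = 1 := by
  have h1 : γ.inv θ * γ'.toFun θ = 1 :=
    calc γ.inv θ * γ'.toFun θ = γ.inv θ * γ.toFun θ := by rw [γ'.eq_self θ hθ, γ.eq_self θ hθ]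
      _ = 1 := γ.inv_mul θ
  rw [moveOp, h1, matCLM_one]

/-- `P_{γ,γ}(θ) = 1`. [folklore] -/
theorem moveOp_self (θ : ℝ) : moveOp γ γ θ = 1 := by
  rw [moveOp, γ.inv_mul, matCLM_one]

/-- The transition operators depend smoothly on `θ`. [folklore] -/
theorem contDiff_moveOp : ContDiff ℝ ∞ (moveOp γ γ') :=
  contDiff_matCLM (SmoothMatrixPath.contDiff_mul_apply γ.contDiff_inv_apply γ'.contDiff_apply)

/-- **Key algebra**: `γ(θ) · (P(θ) v) = γ'(θ) · v`. [folklore] -/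
theorem mulVecE_moveOp (θ : ℝ) (v : 𝔼 3) :
    mulVecE (γ.toFun θ) (moveOp γ γ' θ v) = mulVecE (γ'.toFun θ) v := by
  rw [moveOp, matCLM_apply, mulVecE_mulVecE, ← Matrix.mul_assoc, γ.mul_inv, Matrix.one_mul]

/-- **The closeness threshold** for the transition operators: the straightening threshold of
`FibreStraightening` (for the bump `coreBump` on `𝔼 3`), capped at `1/6` so that close operators
also have norm `≤ 7/6`. [folklore] -/
def fibreThreshold : ℝ := min (straightenThreshold (coreBump (E := 𝔼 3))) (1 / 6)

/-- The threshold is positive. [folklore] -/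
theorem fibreThreshold_pos : 0 < fibreThreshold :=
  lt_min (straightenThreshold_pos _) (by norm_num)

/-- **Uniformly close straightenings** — a binary *relation* on the straightenings of `M₀` (the
closeness hypothesis of the tube move `nonempty_diffeomorph_gompfSphere_of_tubeClose`, not a
statement with a truth value: it holds for `γ' = γ`, `TubeClose.refl`, and every `γ` has a
non-close partner, `exists_not_tubeClose`): all transition operators `γ(θ)⁻¹ γ'(θ)` are within
the threshold `fibreThreshold` of the identity. [folklore] -/
def TubeClose (γ γ' : SmoothMatrixPath M₀) : Prop := ∀ θ, ‖moveOp γ γ' θ - 1‖ < fibreThreshold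

variable {γ γ'}

/-- Close transition operators are below the straightening threshold. [folklore] -/
theorem TubeClose.lt (h : TubeClose γ γ') (θ : ℝ) :
    ‖moveOp γ γ' θ - 1‖ < straightenThreshold (coreBump (E := 𝔼 3)) :=
  (h θ).trans_le (min_le_left _ _)

/-- Close transition operators have norm `≤ 7/6`. [folklore] -/
theorem TubeClose.norm_le (h : TubeClose γ γ') (θ : ℝ) : ‖moveOp γ γ' θ‖ ≤ 7 / 6 := by
  have h1 : ‖moveOp γ γ' θ - 1‖ < 1 / 6 := (h θ).trans_le (min_le_right _ _)
  have h2 : ‖(1 : 𝔼 3 →L[ℝ] 𝔼 3)‖ ≤ 1 := ContinuousLinearMap.norm_id_le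
  calc ‖moveOp γ γ' θ‖ = ‖(moveOp γ γ' θ - 1) + 1‖ := by rw [sub_add_cancel]
    _ ≤ ‖moveOp γ γ' θ - 1‖ + ‖(1 : 𝔼 3 →L[ℝ] 𝔼 3)‖ := norm_add_le _ _
    _ ≤ 7 / 6 := by linarith

variable (γ) in
/-- A straightening is close to itself. [folklore] -/
theorem TubeClose.refl : TubeClose γ γ := fun θ ↦ by
  rw [moveOp_self, sub_self, norm_zero]
  exact fibreThreshold_pos

variable (γ) in
/-- **`TubeClose` is a genuine constraint**: every straightening `γ` of `M₀` has a straightening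
`γ'` of `M₀` with `¬ TubeClose γ γ'` — namely `γ' := γ · (e^{ρ(4θ(1-θ))} · 1)` (`ρ` Mathlib's smooth
transition; a smooth scalar loop at `1`, constant `1` off `(0, 1)`), whose transition operator at
`θ = 1/2` is `e · 1`, at distance `e - 1 > 1 > fibreThreshold` from the identity. So `TubeClose` is a
relation between straightenings (the hypothesis of the tube move), not a statement with a truth
value. [folklore] -/
theorem exists_not_tubeClose : ∃ γ' : SmoothMatrixPath M₀, ¬ TubeClose γ γ' := by
  set φ : ℝ → ℝ := fun θ ↦ Real.smoothTransition (4 * θ * (1 - θ)) with hφ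
  have hφs : ContDiff ℝ ∞ φ := Real.smoothTransition.contDiff.comp (by fun_prop)
  have hφ0 : ∀ θ : ℝ, θ ≤ 0 ∨ 1 ≤ θ → φ θ = 0 := fun θ h ↦
    Real.smoothTransition.zero_of_nonpos (by rcases h with h | h <;> nlinarith)
  have hφhalf : φ (1 / 2) = 1 := by
    simp only [hφ]
    norm_num [Real.smoothTransition.one_of_one_le]
  -- the smooth scalar loop `θ ↦ e^{φ θ} · 1` at `1`
  let δ : SmoothMatrixPath (1 : Matrix (Fin 3) (Fin 3) ℝ) :=
    { toFun := fun θ ↦ Real.exp (φ θ) • (1 : Matrix (Fin 3) (Fin 3) ℝ)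
      inv := fun θ ↦ Real.exp (-φ θ) • (1 : Matrix (Fin 3) (Fin 3) ℝ)
      contDiff_apply := fun i j ↦ by
        simp only [Matrix.smul_apply, smul_eq_mul]
        exact (Real.contDiff_exp.comp hφs).mul contDiff_const
      contDiff_inv_apply := fun i j ↦ by
        simp only [Matrix.smul_apply, smul_eq_mul]
        exact (Real.contDiff_exp.comp hφs.neg).mul contDiff_const
      mul_inv := fun θ ↦ by
        rw [Matrix.smul_mul, Matrix.mul_smul, Matrix.one_mul, smul_smul, ← Real.exp_add,
          add_neg_cancel, Real.exp_zero, one_smul]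
      inv_mul := fun θ ↦ by
        rw [Matrix.smul_mul, Matrix.mul_smul, Matrix.one_mul, smul_smul, ← Real.exp_add,
          neg_add_cancel, Real.exp_zero, one_smul]
      eq_one := fun θ hθ ↦ by
        show Real.exp (φ θ) • (1 : Matrix (Fin 3) (Fin 3) ℝ) = 1
        rw [hφ0 θ (Or.inl hθ), Real.exp_zero, one_smul]
      eq_self := fun θ hθ ↦ by
        show Real.exp (φ θ) • (1 : Matrix (Fin 3) (Fin 3) ℝ) = 1
        rw [hφ0 θ (Or.inr hθ), Real.exp_zero, one_smul] }
  refine ⟨(γ.mul δ).cast (Matrix.mul_one M₀), fun h ↦ ?_⟩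
  -- its transition operator at `θ = 1/2` is `e · 1`
  have hP : moveOp γ ((γ.mul δ).cast (Matrix.mul_one M₀)) (1 / 2) =
      Real.exp 1 • (1 : 𝔼 3 →L[ℝ] 𝔼 3) := by
    show matCLM (γ.inv (1 / 2) * (γ.toFun (1 / 2) * (Real.exp (φ (1 / 2)) • 1))) = _
    rw [← Matrix.mul_assoc, γ.inv_mul, Matrix.one_mul, hφhalf, matCLM_smul_one]
  have h1 := h (1 / 2)
  rw [hP] at h1
  have h2 : fibreThreshold ≤ 1 / 6 := min_le_right _ _
  have h3 : (1 : ℝ) + 1 < Real.exp 1 := Real.add_one_lt_exp one_ne_zero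
  -- `‖e · 1 - 1‖ ≥ e - 1`, tested on a unit vector
  set T : 𝔼 3 →L[ℝ] 𝔼 3 := Real.exp 1 • (1 : 𝔼 3 →L[ℝ] 𝔼 3) - 1 with hT
  set v : 𝔼 3 := EuclideanSpace.single 0 1 with hv
  have hv1 : ‖v‖ = 1 := by simp [hv]
  have h4 : ‖T v‖ ≤ ‖T‖ := by simpa [hv1] using T.le_opNorm v
  have h5 : ‖T v‖ = Real.exp 1 - 1 := by
    have : T v = (Real.exp 1 - 1) • v := by
      simp [hT, sub_smul]
    rw [this, norm_smul, hv1, mul_one, Real.norm_of_nonneg (by linarith)]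
  linarith

end MoveOp

/-! ### The operator family over the circle -/

section Circle

variable {M₀ : Matrix (Fin 3) (Fin 3) ℝ} (γ γ' : SmoothMatrixPath M₀)

/-- **The transition operators over the circle**: `u ↦ P(2 · angA u)` (the tube over the first
piece reads `s ↦ γ(2s)` at level `s = angA u`). [folklore] -/
def moveCLM (u : 𝕊 1) : 𝔼 3 →L[ℝ] 𝔼 3 := moveOp γ γ' (2 * angA u)

/-- Through the second angle chart: off `ptB`, `P(2 · angA u) = P(2 (angB u - 1))` (on the lower
half circle both sides are `1`, on the upper half circle `angB = angA + 1`). [folklore] -/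
theorem moveCLM_eq_of_ne_ptB {u : 𝕊 1} (hu : u ≠ ptB) :
    moveCLM γ γ' u = moveOp γ γ' (2 * (angB u - 1)) := by
  by_cases hA : u = ptA
  · subst hA
    rw [moveCLM, angA_ptA, angB_ptA, moveOp_of_one_le _ _ (by norm_num),
      moveOp_of_le_zero _ _ (by norm_num)]
  · rcases angB_eq_of_ne hA hu with ⟨_, h1⟩ | ⟨hgt, h0⟩
    · rw [moveCLM, h1, add_sub_cancel_right]
    · rw [moveCLM, h0, moveOp_of_one_le _ _ (by linarith),
        moveOp_of_le_zero _ _ (by linarith [(angA_mem_Ioc u).2])]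

/-- At `ptA` the transition operator is `1`. [folklore] -/
theorem moveCLM_ptA : moveCLM γ γ' ptA = 1 := by
  rw [moveCLM, angA_ptA, moveOp_of_one_le _ _ (by norm_num)]

/-- **The transition operators depend smoothly on the point of the circle** (through `angA` off
`ptA` and through `angB` off `ptB`). [folklore] -/
theorem contMDiff_moveCLM : ContMDiff (𝓡 1) 𝓘(ℝ, 𝔼 3 →L[ℝ] 𝔼 3) ∞ (moveCLM γ γ') := by
  intro u
  rcases ne_ptA_or_ne_ptB u with hA | hB
  · have h : ContMDiffAt (𝓡 1) 𝓘(ℝ, ℝ) ∞ (fun v : 𝕊 1 ↦ 2 * angA v) u :=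
      contMDiffAt_const.mul (contMDiffAt_angA hA)
    exact (contDiff_moveOp γ γ').contDiffAt.comp_contMDiffAt h
  · have hev : moveCLM γ γ' =ᶠ[𝓝 u] fun v ↦ moveOp γ γ' (2 * (angB v - 1)) := by
      filter_upwards [isOpen_ne_ptB.mem_nhds hB] with v hv using moveCLM_eq_of_ne_ptB γ γ' hv
    refine ContMDiffAt.congr_of_eventuallyEq ?_ hev
    have h : ContMDiffAt (𝓡 1) 𝓘(ℝ, ℝ) ∞ (fun v : 𝕊 1 ↦ 2 * (angB v - 1)) u :=
      contMDiffAt_const.mul ((contMDiffAt_angB hB).sub contMDiffAt_const)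
    exact (contDiff_moveOp γ γ').contDiffAt.comp_contMDiffAt h

end Circle

/-! ### The fibre reparametrisation of the tube -/

section Fibre

variable (A : Matrix.SpecialLinearGroup (Fin 3) ℤ) {γ γ' : SmoothMatrixPath (slRealMatrix A)}

variable (γ γ') in
/-- The ratio `κ := ε'/ε` of the two tube radii. [folklore] -/
def radiusRatio : ℝ := twistRadius A γ' / twistRadius A γ

variable (γ γ') in
/-- The radius ratio is positive. [folklore] -/
theorem radiusRatio_pos : 0 < radiusRatio A γ γ' :=
  div_pos (twistRadius_pos A γ') (twistRadius_pos A γ)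

variable (γ γ') in
/-- **The fibre maps** `F_u := tubeFibreFun ε κ P_u : ℝ³ → ℝ³` (`= sh_ε⁻¹ ∘ (κ P_u) ∘ sh_ε` on the
unit ball, the identity off `B(0, 7/2)`). [cite: GompfStipsiczGSM1999, §5.2] -/
def moveFibre (u : 𝕊 1) (w : 𝔼 3) : 𝔼 3 :=
  tubeFibreFun (twistRadius_pos A γ) (radiusRatio A γ γ') (moveCLM γ γ' u) w

/-- The fibre maps fix the origin. [folklore] -/
@[simp] theorem moveFibre_apply_zero (u : 𝕊 1) : moveFibre A γ γ' u 0 = 0 :=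
  tubeFibreFun_apply_zero _ _ _

/-- Off `B(0, 7/2)` the fibre maps are the identity. [folklore] -/
theorem moveFibre_of_le_norm (u : 𝕊 1) {w : 𝔼 3} (hw : 7 / 2 ≤ ‖w‖) :
    moveFibre A γ γ' u w = w :=
  tubeFibreFun_of_le_norm _ _ _ hw

/-- **The fibre maps are jointly smooth** on `𝕊¹ × ℝ³` (for close straightenings). [folklore] -/
theorem contMDiff_moveFibre (h : TubeClose γ γ') :
    ContMDiff ((𝓡 1).prod 𝓘(ℝ, 𝔼 3)) 𝓘(ℝ, 𝔼 3) ∞ (uncurry (moveFibre A γ γ')) := by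
  have h1 : ContMDiff ((𝓡 1).prod 𝓘(ℝ, 𝔼 3)) 𝓘(ℝ, (𝔼 3 →L[ℝ] 𝔼 3) × 𝔼 3) ∞
      fun p : (𝕊 1) × 𝔼 3 ↦ (moveCLM γ γ' p.1, p.2) :=
    ((contMDiff_moveCLM γ γ').comp contMDiff_fst).prodMk_space contMDiff_snd
  have h2 : ContMDiffOn 𝓘(ℝ, (𝔼 3 →L[ℝ] 𝔼 3) × 𝔼 3) 𝓘(ℝ, 𝔼 3) ∞
      (fun p : (𝔼 3 →L[ℝ] 𝔼 3) × 𝔼 3 ↦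
        tubeFibreFun (twistRadius_pos A γ) (radiusRatio A γ γ') p.1 p.2)
      {p | ‖p.1 - 1‖ < straightenThreshold (coreBump (E := 𝔼 3))} :=
    (contDiffOn_tubeFibreFun_uncurry (E := 𝔼 3) (twistRadius_pos A γ)
      (radiusRatio A γ γ')).contMDiffOn
  have h3 : ∀ p : (𝕊 1) × 𝔼 3,
      (moveCLM γ γ' p.1, p.2) ∈ {p : (𝔼 3 →L[ℝ] 𝔼 3) × 𝔼 3 |
        ‖p.1 - 1‖ < straightenThreshold (coreBump (E := 𝔼 3))} :=
    fun p ↦ h.lt (2 * angA p.1)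
  have h4 : uncurry (moveFibre A γ γ') = (fun p : (𝔼 3 →L[ℝ] 𝔼 3) × 𝔼 3 ↦
      tubeFibreFun (twistRadius_pos A γ) (radiusRatio A γ γ') p.1 p.2) ∘
        fun p : (𝕊 1) × 𝔼 3 ↦ (moveCLM γ γ' p.1, p.2) := by
    funext ⟨u, w⟩
    rfl
  rw [h4]
  exact h2.comp_contMDiff h1 h3

/-- **The tube reparametrisation** `(u, w) ↦ (u, F_u w)` of `𝕊¹ × ℝ³`: a diffeomorphism (each
`F_u` is a bijective local diffeomorphism, `fibrewiseDiffeomorph`) fixing the zero section and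
equal to the identity off `𝕊¹ × B(0, 7/2)`. [cite: GompfStipsiczGSM1999, §5.2] -/
def moveTubeDiffeo (h : TubeClose γ γ') : TubeDiffeo where
  toDiffeomorph := fibrewiseDiffeomorph (contMDiff_moveFibre A h)
    (fun u ↦ isLocalDiffeomorph_tubeFibreFun (twistRadius_pos A γ) (radiusRatio A γ γ')
      (L := moveCLM γ γ' u) (h.lt (2 * angA u)))
    (fun u ↦ bijective_tubeFibreFun (twistRadius_pos A γ) (radiusRatio A γ γ')
      (L := moveCLM γ γ' u) (h.lt (2 * angA u)))
  radius := 7 / 2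
  apply_zero u := by
    rw [coe_fibrewiseDiffeomorph, fibrewiseFun_apply, moveFibre_apply_zero]
  eq_self p hp := by
    rw [coe_fibrewiseDiffeomorph]
    exact Prod.ext rfl (moveFibre_of_le_norm A p.1 hp)

/-- The tube reparametrisation, pointwise. [folklore] -/
@[simp] theorem moveTubeDiffeo_apply (h : TubeClose γ γ') (u : 𝕊 1) (w : 𝔼 3) :
    (moveTubeDiffeo A h).toDiffeomorph (u, w) = (u, moveFibre A γ γ' u w) := rfl

/-! ### The two tubes agree up to the reparametrisation -/

variable (γ γ') in
/-- The two shrinking maps differ by the radius ratio: `sh_{ε'} = κ · sh_ε`. [folklore] -/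
theorem shrink_eq_smul (w : 𝔼 3) :
    (twistA A γ').shrink w = radiusRatio A γ γ' • (twistA A γ).shrink w := by
  show OpenPartialHomeomorph.univBall (0 : 𝔼 3) (twistRadius A γ') w =
    radiusRatio A γ γ' • OpenPartialHomeomorph.univBall (0 : 𝔼 3) (twistRadius A γ) w
  rw [univBall_zero_eq_smul (twistRadius_pos A γ'), univBall_zero_eq_smul (twistRadius_pos A γ),
    smul_smul (radiusRatio A γ γ') (twistRadius A γ), radiusRatio,
    div_mul_cancel₀ _ (twistRadius_pos A γ).ne']

/-- **On the unit ball, `sh_ε (F_u w) = κ P_u (sh_ε w)`.** [folklore] -/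
theorem shrink_moveFibre (h : TubeClose γ γ') (hκ : radiusRatio A γ γ' ≤ 1) (u : 𝕊 1) {w : 𝔼 3}
    (hw : ‖w‖ ≤ 1) :
    (twistA A γ).shrink (moveFibre A γ γ' u w) =
      radiusRatio A γ γ' • moveCLM γ γ' u ((twistA A γ).shrink w) := by
  have hε := twistRadius_pos A γ
  have hκ₀ := radiusRatio_pos A γ γ'
  have hz : radiusRatio A γ γ' • moveCLM γ γ' u ((twistA A γ).shrink w) ∈
      ball (0 : 𝔼 3) (twistA A γ).ε := by
    rw [mem_ball_zero_iff]
    have h1 : ‖(twistA A γ).shrink w‖ ≤ twistRadius A γ * (18 / 25) := norm_univBall_zero_le hε hw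
    have h2 : ‖moveCLM γ γ' u ((twistA A γ).shrink w)‖ ≤ 7 / 6 * (twistRadius A γ * (18 / 25)) :=
      ((moveCLM γ γ' u).le_opNorm _).trans (mul_le_mul (h.norm_le _) h1 (norm_nonneg _) (by norm_num))
    calc ‖radiusRatio A γ γ' • moveCLM γ γ' u ((twistA A γ).shrink w)‖
        ≤ 1 * (7 / 6 * (twistRadius A γ * (18 / 25))) := by
          rw [norm_smul, Real.norm_of_nonneg hκ₀.le]
          exact mul_le_mul hκ h2 (norm_nonneg _) zero_le_one
      _ < twistRadius A γ := by linarith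
  have hn : ‖moveCLM γ γ' u‖ ≤ 7 / 6 := h.norm_le _
  rw [moveFibre, tubeFibreFun_of_norm_le hε hκ₀ hκ hn hw]
  exact (twistA A γ).shrink_apply_symm_apply hz

/-- **Over the first piece the tubes agree**: `texp_γ s (F_u w) = texp_{γ'} s w` at `s = angA u`,
`u ≠ ptA`, `‖w‖ ≤ 1`. [folklore] -/
theorem texp_twistA_moveFibre (h : TubeClose γ γ') (hκ : radiusRatio A γ γ' ≤ 1) {u : 𝕊 1}
    (hu : u ≠ ptA) {w : 𝔼 3} (hw : ‖w‖ ≤ 1) :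
    (twistA A γ).texp (angAPt u) (moveFibre A γ γ' u w) = (twistA A γ').texp (angAPt u) w := by
  simp only [TubeTwist.texp]
  show expT (mulVecE (γ.toFun (2 * _)) _) = expT (mulVecE (γ'.toFun (2 * _)) _)
  rw [shrink_moveFibre A h hκ u hw, shrink_eq_smul A γ γ', ← ContinuousLinearMap.map_smul_of_tower,
    moveCLM, coe_angAPt hu, mulVecE_moveOp]

/-- **At `ptA` (second piece, level `t = 1`) the tubes agree.** [folklore] -/
theorem texp_twistB_moveFibre_ptA (h : TubeClose γ γ') (hκ : radiusRatio A γ γ' ≤ 1) {w : 𝔼 3}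
    (hw : ‖w‖ ≤ 1) :
    (twistB A γ).texp (angBPt ptA) (moveFibre A γ γ' ptA w) = (twistB A γ').texp (angBPt ptA) w := by
  have h1 : ((angBPt ptA : ℝ)) ≤ 1 := coe_angBPt_ptA.le
  rw [texp_twistB_of_le A γ h1, texp_twistB_of_le A γ' h1, shrink_moveFibre A h hκ ptA hw,
    shrink_eq_smul A γ γ', moveCLM_ptA, one_apply_eq_self]

/-- **The tubes agree up to the reparametrisation on the unit ball**:
`ν_{γ'} (u, w) = ν_γ (u, F_u w)` for `‖w‖ ≤ 1`. [cite: GompfStipsiczGSM1999, §5.2] -/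
theorem secNbhdFun_eq_moveFibre (h : TubeClose γ γ') (hκ : radiusRatio A γ γ' ≤ 1) (u : 𝕊 1)
    {w : 𝔼 3} (hw : ‖w‖ ≤ 1) :
    secNbhdFun A γ' (u, w) = secNbhdFun A γ (u, moveFibre A γ γ' u w) := by
  by_cases hu : u = ptA
  · subst hu
    rw [secNbhdFun_of_ne_ptB A γ' (show ((ptA, w) : (𝕊 1) × 𝔼 3).1 ≠ ptB from ptA_ne_ptB),
      secNbhdFun_of_ne_ptB A γ
        (show ((ptA, moveFibre A γ γ' ptA w) : (𝕊 1) × 𝔼 3).1 ≠ ptB from ptA_ne_ptB),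
      TubeTwist.tubeB_apply, TubeTwist.tubeB_apply]
    dsimp only
    rw [texp_twistB_moveFibre_ptA A h hκ hw]
  · rw [secNbhdFun_of_ne A γ' (show ((u, w) : (𝕊 1) × 𝔼 3).1 ≠ ptA from hu),
      secNbhdFun_of_ne A γ (show ((u, moveFibre A γ γ' u w) : (𝕊 1) × 𝔼 3).1 ≠ ptA from hu),
      TubeTwist.tubeA_apply, TubeTwist.tubeA_apply]
    dsimp only
    rw [texp_twistA_moveFibre A h hκ hu hw]

variable (γ γ') in
/-- **The section circle does not depend on the straightening** (it is the zero section
`[s, 1]`). [folklore] -/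
theorem sectionCircle_eq : sectionCircle A γ = sectionCircle A γ' := by
  funext u
  by_cases hu : u = ptB
  · subst hu
    rw [sectionCircle_of_ne A γ ptA_ne_ptB.symm, sectionCircle_of_ne A γ' ptA_ne_ptB.symm]
  · rw [sectionCircle_of_ne_ptB A γ hu, sectionCircle_of_ne_ptB A γ' hu]

end Fibre

/-! ### The move -/

namespace CircleNbhd

variable {X : Type u} [TopologicalSpace X] [ChartedSpace (𝔼 4) X] [T2Space X]
  [IsManifold (𝓡 4) ∞ X] {c c' : 𝕊 1 → X}

/-- `TubeReparam`'s comparison of surgeries, for tubes around propositionally equal circles.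
[cite: GompfStipsiczGSM1999, §5.2] -/
theorem nonempty_diffeomorph_surgered_of_eqOn_twist_of_eq (ν : CircleNbhd (𝓡 4) c)
    (G : TubeDiffeo) (ν' : CircleNbhd (𝓡 4) c') (hc : c = c')
    (h : ∀ (u : 𝕊 1) (w : 𝔼 3), ‖w‖ < 1 → ν'.toFun (u, w) = ν.toFun (G.toDiffeomorph (u, w))) :
    Nonempty (ν.Surgered ≃ₘ⟮𝓡 4, 𝓡 4⟯ ν'.Surgered) := by
  subst hc
  exact ν.nonempty_diffeomorph_surgered_of_eqOn_twist G ν' h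

end CircleNbhd

section Move

variable (A : Matrix.SpecialLinearGroup (Fin 3) ℤ) {γ γ' : SmoothMatrixPath (slRealMatrix A)}

/-- **The move, oriented by the radii**: for close straightenings with `ε' ≤ ε`,
`gompfSphere A γ ≃ₘ gompfSphere A γ'`. [cite: GompfAGT2010, Def. 4.1 and §4 ¶2] [cite: GompfStipsiczGSM1999, §5.2] -/
theorem nonempty_diffeomorph_gompfSphere_of_tubeClose_of_le (h : TubeClose γ γ')
    (hle : twistRadius A γ' ≤ twistRadius A γ) :
    Nonempty (gompfSphere A γ ≃ₘ⟮𝓡 4, 𝓡 4⟯ gompfSphere A γ') := by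
  have hκ : radiusRatio A γ γ' ≤ 1 := (div_le_one (twistRadius_pos A γ)).2 hle
  refine (sectionCircleNbhd A γ).nonempty_diffeomorph_surgered_of_eqOn_twist_of_eq
    (moveTubeDiffeo A h) (sectionCircleNbhd A γ') (sectionCircle_eq A γ γ') fun u w hw ↦ ?_
  rw [moveTubeDiffeo_apply]
  exact secNbhdFun_eq_moveFibre A h hκ u hw.le

/-- **The move: uniformly close straightenings give diffeomorphic Gompf spheres.** If the
transition operators `γ⁻¹ γ'` and `γ'⁻¹ γ` stay within `fibreThreshold` of the identity, then
`X^γ_A ≃ₘ X^{γ'}_A`. (The local step of **W**: `X^σ_A` depends only on the straightening class.)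
[cite: GompfAGT2010, Def. 4.1 and §4 ¶2] [cite: GompfStipsiczGSM1999, §5.2] -/
theorem nonempty_diffeomorph_gompfSphere_of_tubeClose (h : TubeClose γ γ') (h' : TubeClose γ' γ) :
    Nonempty (gompfSphere A γ ≃ₘ⟮𝓡 4, 𝓡 4⟯ gompfSphere A γ') := by
  rcases le_total (twistRadius A γ') (twistRadius A γ) with hle | hle
  · exact nonempty_diffeomorph_gompfSphere_of_tubeClose_of_le A h hle
  · obtain ⟨e⟩ := nonempty_diffeomorph_gompfSphere_of_tubeClose_of_le A h' hle
    exact ⟨e.symm⟩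

end Move

end Literature.Topology.FourManifolds
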